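import Literature.AnabelianGeometry.EtaleTheta.RigidOfSetting
import Literature.AnabelianGeometry.SemiGraphs.TemperedAnabelianThm66SubProofs
import HarnessLib

/-!
# [EtTh] Cor. 2.18 (i) at the §1 model: the THETA-SUBQUOTIENT clauses from the `Δ`-clause and a
# Prop. 2.4-type extension, by functoriality of profinite completion (proof-only)

Mochizuki, *The étale theta function and its Frobenioid-theoretic manifestations*, Publ. RIMS **45**
(2009) [EtTh], §2, Cor. 2.18 (i), PRIMS PDF p. 60 (printed 286), proof PDF p. 62 (printed 288):
"An algorithm for constructing the subquotients `Π•_Y; Π•_Ÿ; (l·Δ•_Θ); (Δ•_X)^Θ; (Π•_X)^Θ; (Δ•_Y)^Θ;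
(Π•_Y)^Θ` (respectively, `(Π•_X ↠) G•_K`) is described in the proofs of Propositions 1.8, 2.4 [cf. also
the definitions of the various coverings involved!] (respectively, in the proof of [Mzk2], Lemma 1.3.8).
An algorithm for constructing the labels of cuspidal decomposition groups is described in the proof of
Corollary 2.9" [cite: MochizukiEtTh2009, Cor 2.18(i) p.60].  abc-iut cell, layer L2, wave-3 discharge
prover abc-iut-L2-d1 (gen 4), lane C2 (LONG-CHAINS LC-L2-1).  PROOF-ONLY (no `def`, no new named fact,
no instance): nothing of another seat is edited or restated.

WHAT IS KERNEL-CHECKED.  The tree carries Cor. 2.18 (i) as the named FACT `RigidData.Cor218_i` (abc-iut-L2-t2,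
`ThetaRigidity.lean`, F-0620): for every automorphism `γ` of `Π^tp_X̲̲`, SIX invariance clauses — `Π^tp_Y̲̲`,
`Π^tp_Ÿ̲̲`, `Δ`, `Ker(Π^tp_X̲̲ → (Π^tp_X)^Θ)`, the inverse image of `l·Δ_Θ`, the cusp labels.  At abc-iut-L2-t8's
§1 MODEL `C.rigidData μ hC hS h15 L` (`RigidOfSetting.lean`; `PiX = Π^tp_X̲̲ = C.Huu ⊆ Π^tp_X`) the
theta-subquotient clauses are the part the printed proof attributes to "the definitions of the various
coverings involved": once `γ` extends to an automorphism `Γ` of `Π^tp_X` (Prop. 2.4) stabilising `Δ^tp_X`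
([Mzk2] Lem. 1.3.8), the completion `Γ̂` (universal property; L3's `temperedIsoCompletes_holds`)
stabilises `Δ_X = (Δ^tp_X)^∧`, hence `[Δ_X,Δ_X]⁻`, `[[Δ_X,Δ_X],Δ_X]⁻`, hence — root axioms `ker_toTheta` /
`ker_toEll` ([EtTh] p. 12) — `Γ` stabilises `Ker(↠ (Π^tp_X)^Θ)`, the inverse images of `Δ_Θ` and of
`l·Δ_Θ`; restricting to `Π^tp_X̲̲` gives the clauses.  §1 (`TemperedCurve`, generic): `Γ̂` stabilises
`Δ_X` and the two closed commutator subgroups; pull-back to `Π^temp`.  §2 (`ThetaSetting`):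
`map_ker_toTheta_eq`, `map_ker_toEll_eq`, `map_comap_deltaTheta_eq`, `map_comap_lDeltaTheta_eq` from
`D.DeltaTemp.map Γ = D.DeltaTemp` (the tree's standard `hΔ` shape, cf. L3 `TemperedAnabelianThm68Sub`), and
`map_GtpY_eq_of_map_GtpYdd_eq` (`Π^tp_Y = {x | x² ∈ Π^tp_Ÿ}` under `K = K̈`).  §3 (the model): the five
clauses `…_map_eq_of_extends` and the assembly **`rigidData_cor218_i_of_extends`**: `Cor218_i` for the
model GIVEN (a) every `γ ∈ Aut(Π^tp_X̲̲)` extends to some `Γ ∈ Aut(Π^tp_X)` stabilising `Δ^tp_X` and `Π^tp_Ÿ`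
(print: "Propositions 1.8, 2.4", "[Mzk2], Lemma 1.3.8") and (b) the cusp-label clause ("Corollary 2.9")
— the named FACT REDUCED to its anabelian inputs; the `Π•_Y`-, `Δ•`-restricted and theta-subquotient
clauses are theorems.

HONEST FRAMING: [EtTh] is a refereed paper; F-0620 `Cor218_i` stays a named FACT of the cell (this file
is a conditional REDUCTION of it at the model, in the pattern of `RigidData.cor218_iv_surjective_of`);
nothing here asserts the anabelian inputs (a)/(b); no side is taken on [IUTchIII] Cor. 3.12; typed ≠
proved elsewhere.
-/

/-! ### Folklore plumbing (private): images of closures / stable subgroups under `G ≃ₜ* G` -/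

section Folklore

/-- Image of a topological closure under `G ≃ₜ* G` = closure of the image. [folklore] -/
private theorem Subgroup.map_topologicalClosure_continuousMulEquiv {G : Type*} [Group G]
    [TopologicalSpace G] [IsTopologicalGroup G] (e : G ≃ₜ* G) (S : Subgroup G) :
    S.topologicalClosure.map e.toMulEquiv.toMonoidHom = (S.map e.toMulEquiv.toMonoidHom).topologicalClosure := by
  apply SetLike.coe_injective
  rw [Subgroup.coe_map, Subgroup.topologicalClosure_coe, Subgroup.topologicalClosure_coe,
    Subgroup.coe_map]
  exact e.toHomeomorph.image_closure (S : Set G)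

/-- A subgroup stable under `φ : G ≃ₜ* G` is stable under `φ⁻¹`. [folklore] -/
private theorem Subgroup.map_symm_eq_of_map_continuousMulEquiv_eq {G : Type*} [Group G]
    [TopologicalSpace G] {K : Subgroup G} {φ : G ≃ₜ* G}
    (h : K.map φ.toMulEquiv.toMonoidHom = K) : K.map φ.symm.toMulEquiv.toMonoidHom = K := by
  refine le_antisymm ?_ fun x hx => ⟨φ x, h ▸ ⟨x, hx, rfl⟩, φ.symm_apply_apply x⟩
  rintro _ ⟨k, hk, rfl⟩
  rw [← h] at hk
  obtain ⟨k', hk', rfl⟩ := hk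
  change φ.symm (φ k') ∈ K
  rwa [φ.symm_apply_apply]

/-- Membership form of stability: if `K.map φ = K` then `φ x ∈ K ↔ x ∈ K`. [folklore] -/
private theorem Subgroup.continuousMulEquiv_mem_iff_of_map_eq {G : Type*} [Group G]
    [TopologicalSpace G] {K : Subgroup G} {φ : G ≃ₜ* G}
    (h : K.map φ.toMulEquiv.toMonoidHom = K) (x : G) : φ x ∈ K ↔ x ∈ K := by
  constructor
  · intro hx
    rw [← h] at hx
    obtain ⟨y, hy, hyx⟩ := hx
    have : y = x := φ.injective hyx
    exact this ▸ hy
  · intro hx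
    rw [← h]
    exact ⟨x, hx, rfl⟩

end Folklore

/-! ## §1. Profinite completion: an automorphism stabilising `Δ^temp` stabilises `Δ_X`, `[Δ_X,Δ_X]⁻`,
`[[Δ_X,Δ_X],Δ_X]⁻` (generic over L3's `TemperedCurve`) -/

namespace Literature.AnabelianGeometry.SemiGraphs

namespace TemperedCurve

variable {p : ℕ} [Fact p.Prime] (X : TemperedCurve p)

/-- **`Γ̂` stabilises `Δ_X = (ι(Δ^temp_X))⁻`** if `Γ ∈ Aut(Π^temp_X)` stabilises `Δ^temp_X` and `Γ̂ ∈ Aut(Π_X)`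
is its completion (`Γ̂ ∘ ι = ι ∘ Γ`; [SemiAnbd] §6 p. 69 "the `∧` denotes profinite completion, or,
equivalently, closure in `Π_{X_K}`"). [cite: MochizukiEtTh2009, Cor 2.18(i) p.60] -/
theorem map_deltaHat_eq_of_map_deltaTemp_eq (Γ : X.PiTemp ≃ₜ* X.PiTemp) (Γhat : X.PiHat ≃ₜ* X.PiHat)
    (hΓ : ∀ g : X.PiTemp, Γhat (X.toHat g) = X.toHat (Γ g))
    (hΔ : X.DeltaTemp.map Γ.toMulEquiv.toMonoidHom = X.DeltaTemp) :
    X.DeltaHat.map Γhat.toMulEquiv.toMonoidHom = X.DeltaHat := by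
  have hcomp : Γhat.toMulEquiv.toMonoidHom.comp X.toHat.toMonoidHom =
      X.toHat.toMonoidHom.comp Γ.toMulEquiv.toMonoidHom := by
    ext g
    exact hΓ g
  unfold TemperedCurve.DeltaHat
  rw [Subgroup.map_topologicalClosure_continuousMulEquiv, Subgroup.map_map, hcomp, ← Subgroup.map_map,
    hΔ]

/-- **`Γ̂` stabilises `[Δ_X, Δ_X]⁻`** (the kernel of `Δ_X ↠ Δ^ell_X = Δ^ab_X`, [EtTh] p. 12).
[cite: MochizukiEtTh2009, Cor 2.18(i) p.60] -/
theorem map_closure_commutator_deltaHat_eq (Γ : X.PiTemp ≃ₜ* X.PiTemp) (Γhat : X.PiHat ≃ₜ* X.PiHat)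
    (hΓ : ∀ g : X.PiTemp, Γhat (X.toHat g) = X.toHat (Γ g))
    (hΔ : X.DeltaTemp.map Γ.toMulEquiv.toMonoidHom = X.DeltaTemp) :
    (⁅X.DeltaHat, X.DeltaHat⁆.topologicalClosure).map Γhat.toMulEquiv.toMonoidHom =
      ⁅X.DeltaHat, X.DeltaHat⁆.topologicalClosure := by
  have h := X.map_deltaHat_eq_of_map_deltaTemp_eq Γ Γhat hΓ hΔ
  rw [Subgroup.map_topologicalClosure_continuousMulEquiv, Subgroup.map_commutator, h]

/-- **`Γ̂` stabilises `[[Δ_X, Δ_X], Δ_X]⁻`** (the kernel of `Δ_X ↠ Δ^Θ_X`, [EtTh] p. 12).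
[cite: MochizukiEtTh2009, Cor 2.18(i) p.60] -/
theorem map_closure_commutator₃_deltaHat_eq (Γ : X.PiTemp ≃ₜ* X.PiTemp) (Γhat : X.PiHat ≃ₜ* X.PiHat)
    (hΓ : ∀ g : X.PiTemp, Γhat (X.toHat g) = X.toHat (Γ g))
    (hΔ : X.DeltaTemp.map Γ.toMulEquiv.toMonoidHom = X.DeltaTemp) :
    (⁅⁅X.DeltaHat, X.DeltaHat⁆, X.DeltaHat⁆.topologicalClosure).map Γhat.toMulEquiv.toMonoidHom =
      ⁅⁅X.DeltaHat, X.DeltaHat⁆, X.DeltaHat⁆.topologicalClosure := by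
  have h := X.map_deltaHat_eq_of_map_deltaTemp_eq Γ Γhat hΓ hΔ
  rw [Subgroup.map_topologicalClosure_continuousMulEquiv, Subgroup.map_commutator,
    Subgroup.map_commutator, h]

/-- **Pull-back**: if `Γ̂` stabilises `S ⊆ Π_X`, then `Γ` stabilises `ι⁻¹(S) ⊆ Π^temp_X`.
[cite: MochizukiEtTh2009, Cor 2.18(i) p.60] -/
theorem map_comap_toHat_eq_of_map_eq (Γ : X.PiTemp ≃ₜ* X.PiTemp) (Γhat : X.PiHat ≃ₜ* X.PiHat)
    (hΓ : ∀ g : X.PiTemp, Γhat (X.toHat g) = X.toHat (Γ g)) (S : Subgroup X.PiHat)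
    (hS : S.map Γhat.toMulEquiv.toMonoidHom = S) :
    (S.comap X.toHat.toMonoidHom).map Γ.toMulEquiv.toMonoidHom = S.comap X.toHat.toMonoidHom := by
  have key : ∀ (Φ : X.PiTemp ≃ₜ* X.PiTemp) (Φhat : X.PiHat ≃ₜ* X.PiHat),
      (∀ g : X.PiTemp, Φhat (X.toHat g) = X.toHat (Φ g)) → S.map Φhat.toMulEquiv.toMonoidHom = S →
      (S.comap X.toHat.toMonoidHom).map Φ.toMulEquiv.toMonoidHom ≤ S.comap X.toHat.toMonoidHom := by
    intro Φ Φhat hΦ hSΦ y hy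
    obtain ⟨g, hg, rfl⟩ := Subgroup.mem_map.1 hy
    rw [Subgroup.mem_comap] at hg ⊢
    change X.toHat (Φ g) ∈ S
    rw [← hΦ g, Subgroup.continuousMulEquiv_mem_iff_of_map_eq hSΦ]
    exact hg
  refine le_antisymm (key Γ Γhat hΓ hS) ?_
  have hΓ' : ∀ g : X.PiTemp, Γhat.symm (X.toHat g) = X.toHat (Γ.symm g) := fun g => by
    rw [ContinuousMulEquiv.symm_apply_eq, hΓ, ContinuousMulEquiv.apply_symm_apply]
  have h2 := key Γ.symm Γhat.symm hΓ' (Subgroup.map_symm_eq_of_map_continuousMulEquiv_eq hS)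
  intro x hx
  refine ⟨Γ.symm x, h2 ⟨x, hx, rfl⟩, ?_⟩
  exact Γ.apply_symm_apply x

end TemperedCurve

end Literature.AnabelianGeometry.SemiGraphs

/-! ## §2. The theta quotients of the §1 setting are stable under `Δ`-stabilising automorphisms -/

namespace Literature.AnabelianGeometry.EtaleTheta

open Literature.AnabelianGeometry.SemiGraphs

namespace ThetaSetting

variable {p : ℕ} [Fact p.Prime] (D : ThetaSetting p)

/-- **`Ker(Π^tp_X ↠ (Π^tp_X)^Θ)` is stable** under every `Δ^tp_X`-stabilising automorphism of `Π^tp_X`: it is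
the pull-back of `[[Δ_X,Δ_X],Δ_X]⁻` (root axiom `ker_toTheta`, p. 12). [cite: MochizukiEtTh2009, Cor 2.18(i) p.60] -/
theorem map_ker_toTheta_eq (Γ : D.PiTemp ≃ₜ* D.PiTemp)
    (hΔ : D.DeltaTemp.map Γ.toMulEquiv.toMonoidHom = D.DeltaTemp) :
    D.toTheta.ker.map Γ.toMulEquiv.toMonoidHom = D.toTheta.ker := by
  obtain ⟨Γhat, hΓ⟩ := TemperedCurve.temperedIsoCompletes_holds D.toTemperedCurve D.toTemperedCurve Γ
  rw [D.ker_toTheta]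
  exact D.toTemperedCurve.map_comap_toHat_eq_of_map_eq Γ Γhat hΓ _
    (D.toTemperedCurve.map_closure_commutator₃_deltaHat_eq Γ Γhat hΓ hΔ)

/-- **`Ker(Π^tp_X ↠ (Π^tp_X)^ell)` is stable** under every `Δ`-stabilising automorphism of `Π^tp_X`: it is the
pull-back of `[Δ_X,Δ_X]⁻` (root axiom `ker_toEll`, p. 12). [cite: MochizukiEtTh2009, Cor 2.18(i) p.60] -/
theorem map_ker_toEll_eq (Γ : D.PiTemp ≃ₜ* D.PiTemp)
    (hΔ : D.DeltaTemp.map Γ.toMulEquiv.toMonoidHom = D.DeltaTemp) :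
    (D.thetaToEll.comp D.toTheta).ker.map Γ.toMulEquiv.toMonoidHom = (D.thetaToEll.comp D.toTheta).ker := by
  obtain ⟨Γhat, hΓ⟩ := TemperedCurve.temperedIsoCompletes_holds D.toTemperedCurve D.toTemperedCurve Γ
  rw [D.ker_toEll]
  exact D.toTemperedCurve.map_comap_toHat_eq_of_map_eq Γ Γhat hΓ _
    (D.toTemperedCurve.map_closure_commutator_deltaHat_eq Γ Γhat hΓ hΔ)

/-- The inverse image of `Δ_Θ` in `Π^tp_X` is `Ker(Π^tp_X ↠ (Π^tp_X)^ell)`. [cite: MochizukiEtTh2009, §1 p.12] -/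
theorem comap_toTheta_deltaTheta : D.DeltaTheta.comap D.toTheta = (D.thetaToEll.comp D.toTheta).ker := by
  unfold ThetaSetting.DeltaTheta
  rw [MonoidHom.comap_ker]

/-- **The inverse image of `Δ_Θ` is stable** under `Δ`-stabilising automorphisms. [cite: MochizukiEtTh2009, Cor 2.18(i) p.60] -/
theorem map_comap_deltaTheta_eq (Γ : D.PiTemp ≃ₜ* D.PiTemp)
    (hΔ : D.DeltaTemp.map Γ.toMulEquiv.toMonoidHom = D.DeltaTemp) :
    (D.DeltaTheta.comap D.toTheta).map Γ.toMulEquiv.toMonoidHom = D.DeltaTheta.comap D.toTheta := by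
  rw [D.comap_toTheta_deltaTheta]
  exact D.map_ker_toEll_eq Γ hΔ

/-- One inclusion of the `l·Δ_Θ`-clause: an element of the inverse image of `l·Δ_Θ` is `ỹ^l · k` with `ỹ`
over `Δ_Θ` and `k ∈ Ker(↠ Θ)` (`Π^tp_X ↠ (Π^tp_X)^Θ` is onto); both factors are carried to the right place.
[cite: MochizukiEtTh2009, Cor 2.18(i) p.60] -/
theorem map_comap_lDeltaTheta_le (l : ℕ) (Γ : D.PiTemp ≃ₜ* D.PiTemp)
    (hΔ : D.DeltaTemp.map Γ.toMulEquiv.toMonoidHom = D.DeltaTemp) :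
    ((D.lDeltaTheta l).comap D.toTheta).map Γ.toMulEquiv.toMonoidHom ≤ (D.lDeltaTheta l).comap D.toTheta := by
  intro z hz
  obtain ⟨x, hx, rfl⟩ := Subgroup.mem_map.1 hz
  rw [Subgroup.mem_comap] at hx
  obtain ⟨y, hy, hyx⟩ := hx
  obtain ⟨yt, rfl⟩ := D.toTheta_surjective y
  -- `x = yt^l * k` with `k ∈ Ker(toTheta)`
  obtain ⟨k, hk, hx_eq⟩ : ∃ k ∈ D.toTheta.ker, x = yt ^ l * k :=
    ⟨(yt ^ l)⁻¹ * x, by rw [MonoidHom.mem_ker, map_mul, map_inv, map_pow, hyx, inv_mul_cancel],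
      by rw [mul_inv_cancel_left]⟩
  have hyt : yt ∈ D.DeltaTheta.comap D.toTheta := by rw [Subgroup.mem_comap]; exact hy
  have hΓyt : Γ yt ∈ D.DeltaTheta.comap D.toTheta := by
    rw [← Subgroup.continuousMulEquiv_mem_iff_of_map_eq (D.map_comap_deltaTheta_eq Γ hΔ) yt] at hyt
    exact hyt
  have hΓk : Γ k ∈ D.toTheta.ker := by
    rw [← Subgroup.continuousMulEquiv_mem_iff_of_map_eq (D.map_ker_toTheta_eq Γ hΔ) k] at hk
    exact hk
  rw [Subgroup.mem_comap] at hΓyt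
  rw [MonoidHom.mem_ker] at hΓk
  change Γ x ∈ (D.lDeltaTheta l).comap D.toTheta
  rw [Subgroup.mem_comap, hx_eq, map_mul Γ, map_pow Γ, map_mul, map_pow, hΓk, mul_one]
  exact ⟨D.toTheta (Γ yt), hΓyt, rfl⟩

/-- **The inverse image of `l·Δ_Θ` is stable** under `Δ`-stabilising automorphisms (the inclusion for `Γ`
and `Γ⁻¹`). [cite: MochizukiEtTh2009, Cor 2.18(i) p.60] -/
theorem map_comap_lDeltaTheta_eq (l : ℕ) (Γ : D.PiTemp ≃ₜ* D.PiTemp)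
    (hΔ : D.DeltaTemp.map Γ.toMulEquiv.toMonoidHom = D.DeltaTemp) :
    ((D.lDeltaTheta l).comap D.toTheta).map Γ.toMulEquiv.toMonoidHom = (D.lDeltaTheta l).comap D.toTheta := by
  refine le_antisymm (D.map_comap_lDeltaTheta_le l Γ hΔ) ?_
  have h2 := D.map_comap_lDeltaTheta_le l Γ.symm (Subgroup.map_symm_eq_of_map_continuousMulEquiv_eq hΔ)
  intro x hx
  exact ⟨Γ.symm x, h2 ⟨x, hx, rfl⟩, Γ.apply_symm_apply x⟩

/-! ### `Π^tp_Y` from `Π^tp_Ÿ` (under `K = K̈`): `Π^tp_Y = {x ∈ Π^tp_X | x² ∈ Π^tp_Ÿ}` -/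

/-- Under `K = K̈` (`Sec2Hyps`), squares of elements of `Π^tp_Y` lie in `Π^tp_Ÿ` (`[Π^tp_Y : Π^tp_Ÿ] = 2`,
"`Π^tp_X/Π^tp_Ÿ ≅ Z × μ₂`", p. 41). [cite: MochizukiEtTh2009, Def 2.7 p.41] -/
theorem mul_self_mem_GtpYdd_of_mem_GtpY (hS : D.Sec2Hyps) {x : D.PiTemp} (hx : x ∈ D.GtpY) :
    x * x ∈ D.GtpYdd := by
  haveI : D.GtpYdd.Normal := by rw [GtpYdd_eq_GtpYN_two hS]; exact D.GtpYN_normal 2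
  haveI : (D.GtpYdd.subgroupOf D.GtpY).Normal := Subgroup.Normal.subgroupOf inferInstance _
  have h := Subgroup.pow_index_mem (D.GtpYdd.subgroupOf D.GtpY) (⟨x, hx⟩ : D.GtpY)
  have hidx : (D.GtpYdd.subgroupOf D.GtpY).index = 2 := relIndex_GtpYdd_GtpY hS
  rw [hidx, Subgroup.mem_subgroupOf, pow_two] at h
  exact h

/-- Conversely, an element of `Π^tp_X` whose square lies in `Π^tp_Ÿ (⊆ Π^tp_Y = Ker(Π^tp_X ↠ Z))` lies in
`Π^tp_Y` (`Z ≅ ℤ` is torsion-free). [cite: MochizukiEtTh2009, §1 p.12] -/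
theorem mem_GtpY_of_mul_self_mem_GtpYdd {x : D.PiTemp} (hx : x * x ∈ D.GtpYdd) : x ∈ D.GtpY := by
  have h : x * x ∈ D.toZ.ker := D.GtpYdd_le_GtpY hx
  rw [MonoidHom.mem_ker, map_mul] at h
  change x ∈ D.toZ.ker
  rw [MonoidHom.mem_ker]
  have h2 : Multiplicative.toAdd (D.toZ x) + Multiplicative.toAdd (D.toZ x) = 0 := by
    rw [← toAdd_mul, h, toAdd_one]
  have h0 : Multiplicative.toAdd (D.toZ x) = 0 := by omega
  exact Multiplicative.toAdd.injective h0

/-- **The `Π•_Y`-clause follows from the `Π•_Ÿ`-clause** (`K = K̈`): `Π^tp_Y = {x | x² ∈ Π^tp_Ÿ}` (§1-setting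
analogue of abc-iut-L2-t7's `map_PiYtp_eq_of_map_tp_PiX_of_map_PiYddtp`). [cite: MochizukiEtTh2009, Cor 2.18(i) p.60] -/
theorem map_GtpY_eq_of_map_GtpYdd_eq (hS : D.Sec2Hyps) (Γ : D.PiTemp ≃ₜ* D.PiTemp)
    (hYdd : D.GtpYdd.map Γ.toMulEquiv.toMonoidHom = D.GtpYdd) :
    D.GtpY.map Γ.toMulEquiv.toMonoidHom = D.GtpY := by
  have key : ∀ Φ : D.PiTemp ≃ₜ* D.PiTemp, D.GtpYdd.map Φ.toMulEquiv.toMonoidHom = D.GtpYdd →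
      D.GtpY.map Φ.toMulEquiv.toMonoidHom ≤ D.GtpY := by
    intro Φ hΦ y hy
    obtain ⟨x, hx, rfl⟩ := Subgroup.mem_map.1 hy
    apply D.mem_GtpY_of_mul_self_mem_GtpYdd
    change Φ x * Φ x ∈ D.GtpYdd
    rw [← map_mul, Subgroup.continuousMulEquiv_mem_iff_of_map_eq hΦ]
    exact D.mul_self_mem_GtpYdd_of_mem_GtpY hS hx
  refine le_antisymm (key Γ hYdd) ?_
  have h2 := key Γ.symm (Subgroup.map_symm_eq_of_map_continuousMulEquiv_eq hYdd)
  intro x hx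
  exact ⟨Γ.symm x, h2 ⟨x, hx, rfl⟩, Γ.apply_symm_apply x⟩

/-! ## §3. The clauses of `Cor218_i` at the model `C.rigidData μ hC hS h15 L` of `X̲̲` -/

variable {D} {E : D.EtaleThetaData}

namespace EtaleThetaData.DoubleUnderline

variable {l : ℕ} (C : E.DoubleUnderline l) {N : ℕ+} (μ : D.CyclotomeMod l N) (hC : D.Compat)
  (hS : D.Sec2Hyps) (h15 : Prop15iii E hC) (L : C.CuspLabels)

/-- **Restriction**: if `γ ∈ Aut(Π^tp_X̲̲)` is the restriction of `Γ ∈ Aut(Π^tp_X)` stabilising `S ⊆ Π^tp_X`,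
then `γ` stabilises `S ∩ Π^tp_X̲̲`. [cite: MochizukiEtTh2009, Cor 2.18(i) p.60] -/
theorem map_subgroupOf_Huu_eq_of_extends (γ : ↥C.Huu ≃ₜ* ↥C.Huu) (Γ : D.PiTemp ≃ₜ* D.PiTemp)
    (hΓ : ∀ h : C.Huu, Γ (h : D.PiTemp) = ((γ h : C.Huu) : D.PiTemp)) (S : Subgroup D.PiTemp)
    (hS : S.map Γ.toMulEquiv.toMonoidHom = S) :
    (S.subgroupOf C.Huu).map γ.toMulEquiv.toMonoidHom = S.subgroupOf C.Huu := by
  have key : ∀ (φ : ↥C.Huu ≃ₜ* ↥C.Huu) (Φ : D.PiTemp ≃ₜ* D.PiTemp),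
      (∀ h : C.Huu, Φ (h : D.PiTemp) = ((φ h : C.Huu) : D.PiTemp)) →
      S.map Φ.toMulEquiv.toMonoidHom = S →
      (S.subgroupOf C.Huu).map φ.toMulEquiv.toMonoidHom ≤ S.subgroupOf C.Huu := by
    intro φ Φ hΦ hSΦ y hy
    obtain ⟨h, hh, rfl⟩ := Subgroup.mem_map.1 hy
    rw [Subgroup.mem_subgroupOf] at hh ⊢
    change ((φ h : C.Huu) : D.PiTemp) ∈ S
    rw [← hΦ h, Subgroup.continuousMulEquiv_mem_iff_of_map_eq hSΦ]
    exact hh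
  refine le_antisymm (key γ Γ hΓ hS) ?_
  have hΓ' : ∀ h : C.Huu, Γ.symm (h : D.PiTemp) = ((γ.symm h : C.Huu) : D.PiTemp) := fun h => by
    rw [ContinuousMulEquiv.symm_apply_eq, hΓ, ContinuousMulEquiv.apply_symm_apply]
  have h2 := key γ.symm Γ.symm hΓ' (Subgroup.map_symm_eq_of_map_continuousMulEquiv_eq hS)
  intro x hx
  exact ⟨γ.symm x, h2 ⟨x, hx, rfl⟩, γ.apply_symm_apply x⟩

/-- The `Δ` of the model rigid data is `Δ^tp_X ∩ Π^tp_X̲̲` (bookkeeping).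
[cite: MochizukiEtTh2009, Cor 2.18 p.59] -/
theorem rigidData_aug_ker : (C.rigidData μ hC hS h15 L).aug.ker = D.DeltaTemp.subgroupOf C.Huu := by
  ext x
  change x ∈ ((D.aug.toMonoidHom.comp C.Huu.subtype).codRestrict D.GK
    fun x => D.aug_mem_GK (x : D.PiTemp)).ker ↔ _
  rw [MonoidHom.ker_codRestrict, MonoidHom.mem_ker, MonoidHom.coe_comp, Function.comp_apply,
    Subgroup.coe_subtype, Subgroup.mem_subgroupOf]
  rfl

/-- The `thetaKer` of the model rigid data is `Ker(Π^tp_X ↠ (Π^tp_X)^Θ) ∩ Π^tp_X̲̲` (bookkeeping).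
[cite: MochizukiEtTh2009, Cor 2.18 p.59] -/
theorem rigidData_thetaKer : (C.rigidData μ hC hS h15 L).thetaKer = D.toTheta.ker.subgroupOf C.Huu := by
  change (D.toTheta.comp C.Huu.subtype).ker = _
  rw [← MonoidHom.comap_ker]
  rfl

/-- The `lDeltaTheta` of the model rigid data is (inverse image of `l·Δ_Θ` in `Π^tp_X`) `∩ Π^tp_X̲̲`
(bookkeeping). [cite: MochizukiEtTh2009, Cor 2.18 p.59] -/
theorem rigidData_lDeltaTheta :
    (C.rigidData μ hC hS h15 L).lDeltaTheta = ((D.lDeltaTheta l).comap D.toTheta).subgroupOf C.Huu := by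
  change (D.lDeltaTheta l).comap (D.toTheta.comp C.Huu.subtype) = _
  rw [← Subgroup.comap_comap]
  rfl

/-- **Cor. 2.18 (i), clause `(Π•_X ↠) G•_K` at the model**: `γ` extending to a `Δ^tp_X`-stabilising `Γ`
stabilises `Δ_X̲̲ = Δ^tp_X ∩ Π^tp_X̲̲`. [cite: MochizukiEtTh2009, Cor 2.18(i) p.60] -/
theorem rigidData_augKer_map_eq_of_extends (γ : ↥C.Huu ≃ₜ* ↥C.Huu) (Γ : D.PiTemp ≃ₜ* D.PiTemp)
    (hΓ : ∀ h : C.Huu, Γ (h : D.PiTemp) = ((γ h : C.Huu) : D.PiTemp))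
    (hΔ : D.DeltaTemp.map Γ.toMulEquiv.toMonoidHom = D.DeltaTemp) :
    (C.rigidData μ hC hS h15 L).aug.ker.map γ.toMulEquiv.toMonoidHom = (C.rigidData μ hC hS h15 L).aug.ker := by
  rw [rigidData_aug_ker]
  exact C.map_subgroupOf_Huu_eq_of_extends γ Γ hΓ _ hΔ

/-- **Cor. 2.18 (i), clause `(Π•_X)^Θ` at the model — DERIVED**: `γ` extending to a `Δ^tp_X`-stabilising
`Γ` stabilises `Ker(Π^tp_X̲̲ → (Π^tp_X)^Θ)`. [cite: MochizukiEtTh2009, Cor 2.18(i) p.60] -/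
theorem rigidData_thetaKer_map_eq_of_extends (γ : ↥C.Huu ≃ₜ* ↥C.Huu) (Γ : D.PiTemp ≃ₜ* D.PiTemp)
    (hΓ : ∀ h : C.Huu, Γ (h : D.PiTemp) = ((γ h : C.Huu) : D.PiTemp))
    (hΔ : D.DeltaTemp.map Γ.toMulEquiv.toMonoidHom = D.DeltaTemp) :
    (C.rigidData μ hC hS h15 L).thetaKer.map γ.toMulEquiv.toMonoidHom =
      (C.rigidData μ hC hS h15 L).thetaKer := by
  rw [rigidData_thetaKer]
  exact C.map_subgroupOf_Huu_eq_of_extends γ Γ hΓ _ (D.map_ker_toTheta_eq Γ hΔ)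

/-- **Cor. 2.18 (i), clause `(l·Δ•_Θ)` at the model — DERIVED**: `γ` extending to a `Δ^tp_X`-stabilising
`Γ` stabilises the inverse image of `l·Δ_Θ` in `Π^tp_X̲̲`. [cite: MochizukiEtTh2009, Cor 2.18(i) p.60] -/
theorem rigidData_lDeltaTheta_map_eq_of_extends (γ : ↥C.Huu ≃ₜ* ↥C.Huu) (Γ : D.PiTemp ≃ₜ* D.PiTemp)
    (hΓ : ∀ h : C.Huu, Γ (h : D.PiTemp) = ((γ h : C.Huu) : D.PiTemp))
    (hΔ : D.DeltaTemp.map Γ.toMulEquiv.toMonoidHom = D.DeltaTemp) :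
    (C.rigidData μ hC hS h15 L).lDeltaTheta.map γ.toMulEquiv.toMonoidHom =
      (C.rigidData μ hC hS h15 L).lDeltaTheta := by
  rw [rigidData_lDeltaTheta]
  exact C.map_subgroupOf_Huu_eq_of_extends γ Γ hΓ _ (D.map_comap_lDeltaTheta_eq l Γ hΔ)

/-- **[EtTh] Cor. 2.18 (i) at the §1 model, REDUCED to its anabelian inputs.**  The named fact
`RigidData.Cor218_i` HOLDS for `C.rigidData μ hC hS h15 L` as soon as
(a) every automorphism `γ` of the topological group `Π^tp_X̲̲` extends to an automorphism `Γ` of `Π^tp_X`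
stabilising `Δ^tp_X` and `Π^tp_Ÿ` (print: "described in the proofs of Propositions 1.8, 2.4" and
"[Mzk2], Lemma 1.3.8"), and (b) every `γ` respects the cusp labels `∈ (ℤ/lℤ)^±` (print: "the proof of
Corollary 2.9").  The clauses `Π•_Y` (`= {x | x² ∈ Π•_Ÿ}`), `(l·Δ•_Θ)`, `(Δ•_X)^Θ`/`(Π•_X)^Θ` are then
THEOREMS ("the definitions of the various coverings involved", via functoriality of profinite
completion).
[cite: MochizukiEtTh2009, Cor 2.18(i) p.60] -/
theorem rigidData_cor218_i_of_extends
    (hext : ∀ γ : ↥C.Huu ≃ₜ* ↥C.Huu, ∃ Γ : D.PiTemp ≃ₜ* D.PiTemp,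
      (∀ h : C.Huu, Γ (h : D.PiTemp) = ((γ h : C.Huu) : D.PiTemp)) ∧
      D.DeltaTemp.map Γ.toMulEquiv.toMonoidHom = D.DeltaTemp ∧
      D.GtpYdd.map Γ.toMulEquiv.toMonoidHom = D.GtpYdd)
    (hcusp : ∀ (γ : ↥C.Huu ≃ₜ* ↥C.Huu) (a : ZMod l),
      (fun H : Subgroup C.Huu => H.map γ.toMulEquiv.toMonoidHom) '' L.cuspX a = L.cuspX a) :
    (C.rigidData μ hC hS h15 L).Cor218_i := by
  intro γ
  obtain ⟨Γ, hΓ, hΔ, hYdd⟩ := hext γ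
  have hY := D.map_GtpY_eq_of_map_GtpYdd_eq hS Γ hYdd
  exact ⟨C.map_subgroupOf_Huu_eq_of_extends γ Γ hΓ _ hY, C.map_subgroupOf_Huu_eq_of_extends γ Γ hΓ _ hYdd,
    C.rigidData_augKer_map_eq_of_extends μ hC hS h15 L γ Γ hΓ hΔ,
    C.rigidData_thetaKer_map_eq_of_extends μ hC hS h15 L γ Γ hΓ hΔ,
    C.rigidData_lDeltaTheta_map_eq_of_extends μ hC hS h15 L γ Γ hΓ hΔ,
    hcusp γ⟩

end EtaleThetaData.DoubleUnderline

end ThetaSetting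

end Literature.AnabelianGeometry.EtaleTheta
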